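import Literature.NumberTheory.LFunctions.JensenTuranCriterion
import Literature.NumberTheory.LFunctions.JensenPolyaProofs
import HarnessLib

/-!
# O'Sullivan's Hermite–Jensen criterion for the Riemann hypothesis (proved)

C. O'Sullivan, *Zeros of Jensen polynomials and asymptotics for the Riemann xi function*, Res. Math.
Sci. 8 (2021) 46 = arXiv:2007.13582 [Osullivan2021]. With `γ` the Taylor coefficients of `ξ` at
`½` (O'Sullivan (1.2): `Θ(z) = ξ(½ + √z) = Σ γ(m) zᵐ/m!`; the tree's `xiTaylorCoeff = 8γ`, GORZ's
normalisation — every statement below is invariant under scaling `γ`), the Jensen polynomials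
`J^{d,n}(X) = Σ_j (d choose j) γ(n+j) X^j` (tree: `jensenPoly`) and the physicists' Hermite
polynomials `H_k` (generating function `e^{2Xt - t²}`, §2), O'Sullivan sets [Osullivan2021, (1.4)]

  `P^{d,n}(X) := Σ_{j=0}^{d} (d choose j) γ(n+j) H_{d-j}(X)`

and proves
* **Theorem 1.2**: RH ⟺ `P^{d,n}` is hyperbolic for all `d ≥ 1`, `n ≥ 0`;
* **Corollary 3.8** (via Pólya 1915 = Turán 1959 Lemma II, his Corollary 3.7: `Σ a_j z^j`
  hyperbolic ⟹ `Σ a_j H_j(z)` hyperbolic): `J^{d,n}` hyperbolic ⟹ `P^{d,n}` hyperbolic;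
* **Theorem 1.3**: for all `d` sufficiently large, `P^{d,n}` is hyperbolic whenever
  `n/log² n ≥ d^{3/4}/2` (from the asymptotics of `γ(n)`, Thm. 1.4, and Turán's criterion Thm. 8.1).

In the tree's normalisation `gorzHermite k = H_k(X/2)` (`JensenHermite.lean`), O'Sullivan's (3.8)
reads `P^{d,n}(X/2) = Σ_{k ≤ d} (d choose k) γ(n + d - k) · gorzHermite k
= hermiteSum (hermiteJensenCoeff γ d n) d =: hermiteJensenPoly γ d n` (same zeros up to `X ↦ X/2`;
this is the object of the `rh-jensen` column's sub-row J-C′, copied from its theory seat's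
`RhJensen.hermiteJensenPoly`). "Hyperbolic" = `Polynomial.Splits` over `ℝ`, as everywhere in the
tree (`JensenPolyaCriterion`).

## Contents

* `hermiteJensenCoeff`, `hermiteJensenPoly` — O'Sullivan's `P^{d,n}_γ(X/2)` [(1.4), (3.8)].
* `aeval_derivOp_gaussTaylor_X_pow` — `H_d(X/2) = e^{-D²} X^d` (`D = d/dX`; the operator form of
  "`g*_d(e^{-z²}; x) = H_d(x/2)`" and "`Φ(D) z^d = g*_d(Φ; z)`", [Osullivan2021, §3.1–3.2]), PROVED;
  hence `hermiteSum c N = e^{-D²} (Σ_{j ≤ N} c_j X^j)` (`aeval_derivOp_gaussTaylor_sum`).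
* `splits_hermiteSum_of_splits` — **Corollary 3.7** (Pólya 1915; Turán 1959, Lemma II): if
  `Σ_{j ≤ N} a_j X^j` is hyperbolic then so is `Σ_{j ≤ N} a_j H_j(X/2)`, PROVED: `e^{-D²} p` is the
  coefficientwise limit of `(1 - D²/n)ⁿ p`, each hyperbolic by the Hermite–Poulain theorem (tree:
  `PolyaSchur.splits_aeval_derivOp_apply`), and hyperbolicity with bounded degree is closed under
  coefficientwise limits (tree: `PolyaSchur.splits_of_tendsto_coeff`, Hurwitz).
* `osullivan2021_cor3_8` — **Corollary 3.8**, PROVED: `(jensenPoly γ d n).Splits →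
  (hermiteJensenPoly γ d n).Splits` (the reciprocal polynomial of `J^{d,n}` has coefficient vector
  `hermiteJensenCoeff`, `reflect_jensenPoly`).
* `jensenPoly_gaussTwistSeq_eq_reflect` — Lemma 3.4 / (3.8) at shift `0`, PROVED: the Jensen
  polynomial `g_d` of the product `e^{-z²} · Σ γ(i) zⁱ/i!` is the reciprocal of `P^{d,0}_γ(X/2)`.
* `riemannHypothesis_of_forall_splits_hermiteJensenPoly_zero` — the hard half of **Theorem 1.2**,
  in the sharper shift-zero form of Theorem 3.5 (`Ω = e^{-z²}`, `n = 0`), PROVED: if every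
  `P^{d,0}`, `d ≥ 1`, is hyperbolic then RH. Proof as printed (easy direction of Pólya–Schur):
  the Jensen polynomials of `F(w) = e^{-w²} · 8ξ(½ + √w)` are hyperbolic, `g_d(F; w/d) → F`
  locally uniformly, Hurwitz (tree: `PolyaSchur.im_eq_zero_of_forall_splits_jensenPoly`), so the
  zeros of `ξ(½ + √w)` are real, which is RH (tree:
  `riemannHypothesis_of_forall_xiSq_eq_zero_im_eq_zero`).
* `osullivan2021_thm1_2` — **Theorem 1.2**, PROVED: `RiemannHypothesis ↔ ∀ d n, 1 ≤ d →
  (hermiteJensenPoly xiTaylorCoeff d n).Splits` (⟹: Pólya's criterion `polya_jensen_holds` and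
  Cor. 3.8); and `riemannHypothesis_iff_forall_splits_hermiteJensenPoly_zero` (shift `0` suffices).
* `osullivan2021_thm1_3` — **Theorem 1.3** as a NAMED FACT (not proved here: it rests on the full
  asymptotic expansion Thm. 1.4 of `γ(n)`; "`d` sufficiently large" is INEFFECTIVE in print).

No other named facts. What is NOT here: Theorem 1.4–1.8 (asymptotics of `γ(n)`), Theorem 3.9
(Laguerre variant), §8's Lemma 8.2.

## References
* [Osullivan2021] C. O'Sullivan, Res. Math. Sci. 8 (2021) 46 = arXiv:2007.13582: (1.4), Thm. 1.2,
  Thm. 1.3 (p. 2); §3.1 (Pólya–Schur, `Φ(D)z^d = g*_d(Φ;z)`), Lemma 3.4, Thm. 3.5, (3.8), Thm. 3.6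
  (Pólya 1915), Cor. 3.7 (= Turán 1959 Lemma II), Cor. 3.8 (pp. 6–7); Thm. 8.1, (8.3) (p. 17).
* [Polya1927], [CravenCsordas1989], [Obreschkoff1963] — as used in
  `Literature/Analysis/Complex/JensenPolynomialHyperbolicity.lean`.
-/

noncomputable section

open Polynomial Finset Filter Topology
open scoped Nat

namespace Literature.NumberTheory.LFunctions

open Literature.Analysis.Complex.PolyaSchur

/-! ## O'Sullivan's polynomials `P^{d,n}` in the tree's Hermite normalisation -/

/-- The coefficient vector of `P^{d,n}_γ(X/2)` in the basis `gorzHermite k = H_k(X/2)`: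
`b_k = (d choose k) · γ(n + (d - k))` (O'Sullivan (1.4) with `k = d - j`; for `k > d` the binomial
coefficient vanishes). [cite: Osullivan2021, eq. (1.4) and (3.8)] -/
def hermiteJensenCoeff (γ : ℕ → ℝ) (d n k : ℕ) : ℝ :=
  (d.choose k : ℝ) * γ (n + (d - k))

/-- **O'Sullivan's Hermite–Jensen polynomial** of degree `d` and shift `n` of a sequence `γ`, in
the tree's Hermite normalisation: `hermiteJensenPoly γ d n = P^{d,n}_γ(X/2)
= Σ_{k ≤ d} (d choose k) γ(n + d - k) · H_k(X/2) = hermiteSum (hermiteJensenCoeff γ d n) d`, where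
`P^{d,n}(X) := Σ_{j ≤ d} (d choose j) γ(n+j) H_{d-j}(X)` [Osullivan2021, (1.4)] and
`P^{d,n}(x/2) = g*_d(Θ⁽ⁿ⁾ · e^{-z²}; x)` [Osullivan2021, (3.8)]. It is hyperbolic iff `P^{d,n}_γ`
is. [cite: Osullivan2021, eq. (1.4) and (3.8)] -/
def hermiteJensenPoly (γ : ℕ → ℝ) (d n : ℕ) : ℝ[X] :=
  hermiteSum (hermiteJensenCoeff γ d n) d

/-- Unfolding lemma. [cite: Osullivan2021, eq. (3.8)] -/
theorem hermiteJensenPoly_def (γ : ℕ → ℝ) (d n : ℕ) :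
    hermiteJensenPoly γ d n = ∑ k ∈ range (d + 1), C (hermiteJensenCoeff γ d n k) * gorzHermite k :=
  rfl

/-- `deg (Σ_{j ≤ N} c_j H_j(X/2)) ≤ N`. [folklore] -/
private theorem hermiteSum_natDegree_le (c : ℕ → ℝ) (N : ℕ) : (hermiteSum c N).natDegree ≤ N := by
  unfold hermiteSum
  refine natDegree_sum_le_of_forall_le _ _ fun j hj => ?_
  calc (C (c j) * gorzHermite j).natDegree ≤ (gorzHermite j).natDegree := natDegree_C_mul_le _ _
    _ = j := natDegree_gorzHermite j
    _ ≤ N := by have := mem_range.mp hj; omega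

/-- `deg P^{d,n}_γ(X/2) ≤ d`. [cite: Osullivan2021, eq. (1.4)] -/
theorem natDegree_hermiteJensenPoly_le (γ : ℕ → ℝ) (d n : ℕ) :
    (hermiteJensenPoly γ d n).natDegree ≤ d :=
  hermiteSum_natDegree_le _ d

/-- Audit against the paper at `d = 2`: `P^{2,n}(X/2) = γ(n+2) + 2γ(n+1)·X + γ(n)(X² - 2)`, whose
discriminant condition is O'Sullivan's (1.6) `γ(n+1)² + 2γ(n)² ≥ γ(n)γ(n+2)`.
[cite: Osullivan2021, eq. (1.4) and (1.6)] -/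
theorem hermiteJensenPoly_two (γ : ℕ → ℝ) (n : ℕ) :
    hermiteJensenPoly γ 2 n = C (γ (n + 2)) + C (2 * γ (n + 1)) * X + C (γ n) * (X ^ 2 - C 2) := by
  simp only [hermiteJensenPoly, hermiteSum, hermiteJensenCoeff, sum_range_succ, sum_range_zero,
    zero_add, gorzHermite_two]
  have h0 : gorzHermite 0 = 1 := by
    rw [gorzHermite, gorzHermiteGen]; simp
  have h1 : gorzHermite 1 = X := by
    rw [gorzHermite, gorzHermiteGen]; simp [sum_range_succ]
  rw [h0, h1]
  norm_num [Nat.choose]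

/-! ## Generic coefficient bookkeeping -/

/-- Coefficients of `Σ_{i ≤ N} f(i) X^i`. [folklore] -/
private theorem coeff_sum_range_C_mul_X_pow (f : ℕ → ℝ) (N k : ℕ) :
    (∑ i ∈ range (N + 1), C (f i) * X ^ i).coeff k = if k ≤ N then f k else 0 := by
  rw [finsetSum_coeff]
  simp only [coeff_C_mul_X_pow]
  rw [Finset.sum_ite_eq (range (N + 1)) k]
  simp

/-- `deg (Σ_{i ≤ N} f(i) X^i) ≤ N`. [folklore] -/
private theorem natDegree_sum_range_C_mul_X_pow_le (f : ℕ → ℝ) (N : ℕ) :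
    (∑ i ∈ range (N + 1), C (f i) * X ^ i).natDegree ≤ N := by
  refine natDegree_le_iff_coeff_eq_zero.2 fun k hk => ?_
  rw [coeff_sum_range_C_mul_X_pow, if_neg (by exact_mod_cast not_le.2 hk)]

/-- **`q(D) p` only sees the coefficients of `q` up to `deg p`**:
`q(D) p = Σ_{i ≤ N} q_i · p⁽ⁱ⁾` whenever `deg p ≤ N`. [folklore] -/
private theorem aeval_derivOp_apply_eq_sum {p : ℝ[X]} {N : ℕ} (hp : p.natDegree ≤ N) (q : ℝ[X]) :
    aeval derivOp q p = ∑ i ∈ range (N + 1), q.coeff i • derivative^[i] p := by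
  induction q using Polynomial.induction_on' with
  | add q₁ q₂ h₁ h₂ =>
    rw [map_add, LinearMap.add_apply, h₁, h₂, ← sum_add_distrib]
    refine sum_congr rfl fun i _ => ?_
    rw [coeff_add, add_smul]
  | monomial m a =>
    rw [aeval_derivOp_monomial_apply]
    simp only [coeff_monomial]
    have hre : ∀ i ∈ range (N + 1),
        (if m = i then a else 0) • derivative^[i] p = if m = i then a • derivative^[i] p else 0 :=
      fun i _ => by split_ifs <;> simp
    rw [sum_congr rfl hre, sum_ite_eq]
    split_ifs with h
    · rfl
    · rw [iterate_derivative_eq_zero (lt_of_le_of_lt hp (by simpa [Nat.lt_succ_iff] using h)),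
        smul_zero]

/-- The reflection `reflect N` is an involution. [folklore] -/
private theorem reflect_reflect (N : ℕ) (f : ℝ[X]) : reflect N (reflect N f) = f := by
  ext i
  rw [coeff_reflect, coeff_reflect, revAt_invol]

/-! ## The Gauss–Weierstrass operator `e^{-D²}` on polynomials and `H_d(X/2) = e^{-D²} X^d` -/

/-- The Taylor polynomial of `e^{-X²}` of degree `N`: `Σ_{i ≤ N} c_i X^i`, `c = expNegSqCoeff`
(`c_{2r} = (-1)^r/r!`, `c_odd = 0`). Its value at `D = d/dX` acts as `e^{-D²}` on polynomials of
degree `≤ N`. [cite: Osullivan2021, §3.2 (the Laguerre–Pólya function `e^{-z²}`)] -/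
def gaussTaylor (N : ℕ) : ℝ[X] := ∑ i ∈ range (N + 1), C (expNegSqCoeff i) * X ^ i

/-- Coefficients of `gaussTaylor N`. [folklore] -/
private theorem coeff_gaussTaylor (N k : ℕ) :
    (gaussTaylor N).coeff k = if k ≤ N then expNegSqCoeff k else 0 :=
  coeff_sum_range_C_mul_X_pow _ N k

/-- `(-1)^i c_i = c_i` for the Taylor coefficients of the even function `e^{-X²}`. [folklore] -/
private theorem neg_one_pow_mul_expNegSqCoeff (i : ℕ) :
    (-1 : ℝ) ^ i * expNegSqCoeff i = expNegSqCoeff i := by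
  rcases Nat.even_or_odd i with h | h
  · rw [h.neg_one_pow, one_mul]
  · rw [expNegSqCoeff_of_odd h, mul_zero]

/-- **`H_j(X/2) = e^{-D²} X^j`** (`j ≤ N`, `e^{-D²}` truncated at order `N`): the operator form of
O'Sullivan's `g*_d(e^{-z²}; x) = H_d(x/2)` [Osullivan2021, display before (3.8)] combined with
Pólya–Schur's `Φ(D) z^d = g*_d(Φ; z)` [Osullivan2021, §3.1, sketch of proof of Thm. 3.1]; in GORZ's
closed form `H_d = d! Σ_k (-1)^{d-k} c_{d-k} X^k/k!` (`coeff_gorzHermite`) this is the identity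
`d!/k! = d(d-1)⋯(k+1)`. [cite: Osullivan2021, §3.2 eq. (3.8)] -/
theorem aeval_derivOp_gaussTaylor_X_pow {j N : ℕ} (hj : j ≤ N) :
    aeval derivOp (gaussTaylor N) ((X : ℝ[X]) ^ j) = gorzHermite j := by
  rw [aeval_derivOp_apply_eq_sum ((natDegree_X_pow_le j).trans hj)]
  ext m
  rw [finsetSum_coeff, coeff_gorzHermite]
  simp only [coeff_smul, coeff_iterate_derivative, coeff_X_pow, smul_eq_mul, coeff_gaussTaylor]
  rcases le_or_gt m j with hmj | hmj
  · rw [if_pos hmj, Finset.sum_eq_single (j - m)]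
    · have hi : j - m ≤ N := (Nat.sub_le j m).trans hj
      have hmij : m + (j - m) = j := Nat.add_sub_cancel' hmj
      rw [if_pos hi, hmij, if_pos rfl, nsmul_eq_mul, mul_one]
      have hm0 : (m ! : ℝ) ≠ 0 := by positivity
      have hdesc : ((j.descFactorial (j - m) : ℕ) : ℝ) * m ! = j ! := by
        have h := Nat.factorial_mul_descFactorial (Nat.sub_le j m)
        rw [Nat.sub_sub_self hmj] at h
        rw [mul_comm]
        exact_mod_cast h
      rw [show (j ! : ℝ) * (-1) ^ (j - m) * expNegSqCoeff (j - m) / m ! =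
          ((-1) ^ (j - m) * expNegSqCoeff (j - m)) * ((j ! : ℝ) / m !) by ring,
        neg_one_pow_mul_expNegSqCoeff]
      congr 1
      rw [eq_div_iff hm0, hdesc]
    · intro i _ hne
      have : m + i ≠ j := fun h => hne (by omega)
      simp [this]
    · intro h
      exfalso
      simp only [mem_range, not_lt] at h
      omega
  · rw [if_neg (not_le.2 hmj)]
    refine Finset.sum_eq_zero fun i _ => ?_
    have : m + i ≠ j := by omega
    simp [this]

/-- `Σ_{j ≤ N} c_j H_j(X/2) = e^{-D²} (Σ_{j ≤ N} c_j X^j)` (with `e^{-D²}` truncated at any order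
`M ≥ N`): Pólya's Hermite-expansion map is the Gauss–Weierstrass operator
(O'Sullivan's use of Thm. 3.6 with `Ω = e^{-z²}`, `Ω⁽ʲ⁾ = (-1)^j e^{-z²} H_j`).
[cite: Osullivan2021, Thm. 3.6 and Cor. 3.7] -/
theorem aeval_derivOp_gaussTaylor_sum (c : ℕ → ℝ) {N M : ℕ} (hNM : N ≤ M) :
    aeval derivOp (gaussTaylor M) (∑ j ∈ range (N + 1), C (c j) * X ^ j) = hermiteSum c N := by
  rw [map_sum, hermiteSum]
  refine sum_congr rfl fun j hj => ?_
  have hjM : j ≤ M := by have := mem_range.mp hj; omega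
  rw [← smul_eq_C_mul, map_smul, aeval_derivOp_gaussTaylor_X_pow hjM, smul_eq_C_mul]

/-! ## Corollary 3.7 (Pólya 1915; Turán 1959, Lemma II): `Σ a_j X^j` hyperbolic ⟹ `Σ a_j H_j` hyperbolic -/

/-- The real-rooted approximants `(1 - X²/n)ⁿ` of `e^{-X²}` (roots `±√n`). [folklore] -/
private def gaussApprox (n : ℕ) : ℝ[X] := (1 - C ((n : ℝ)⁻¹) * X ^ 2) ^ n

/-- Binomial expansion of `(1 - X²/n)ⁿ`. [folklore] -/
private theorem gaussApprox_eq_sum (n : ℕ) :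
    gaussApprox n = ∑ k ∈ range (n + 1), C ((n.choose k : ℝ) * (-(n : ℝ)⁻¹) ^ k) * X ^ (2 * k) := by
  rw [gaussApprox, sub_eq_add_neg, add_comm, add_pow]
  refine sum_congr rfl fun k _ => ?_
  rw [one_pow, mul_one, ← C_eq_natCast,
    show -(C ((n : ℝ)⁻¹) * X ^ 2) = C (-(n : ℝ)⁻¹) * X ^ 2 by rw [C_neg, neg_mul], mul_pow, ← C_pow,
    ← pow_mul, map_mul]
  ring

/-- Coefficients of `(1 - X²/n)ⁿ`: `[X^{2k}] = (n choose k)(-1/n)^k` for `k ≤ n`, else `0`.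
[folklore] -/
private theorem coeff_gaussApprox (n i : ℕ) :
    (gaussApprox n).coeff i =
      if Even i ∧ i / 2 ≤ n then (n.choose (i / 2) : ℝ) * (-(n : ℝ)⁻¹) ^ (i / 2) else 0 := by
  rw [gaussApprox_eq_sum, finsetSum_coeff]
  simp only [coeff_C_mul_X_pow]
  split_ifs with h
  · obtain ⟨⟨r, hr⟩, hrn⟩ := h
    have hi2 : i / 2 = r := by omega
    rw [Finset.sum_eq_single r]
    · rw [if_pos (by omega), hi2]
    · intro k _ hk
      rw [if_neg (by omega)]
    · intro hk
      exfalso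
      simp only [mem_range, not_lt] at hk
      omega
  · refine Finset.sum_eq_zero fun k hk => ?_
    rw [if_neg]
    intro hik
    apply h
    have hk' := mem_range.mp hk
    exact ⟨⟨k, by omega⟩, by omega⟩

/-- `[X^i] (1 - X²/n)ⁿ → c_i = [X^i] e^{-X²}` as `n → ∞` (`(n choose r)/n^r → 1/r!`).
[folklore] -/
private theorem tendsto_coeff_gaussApprox (i : ℕ) :
    Tendsto (fun n => (gaussApprox n).coeff i) atTop (𝓝 (expNegSqCoeff i)) := by
  rcases Nat.even_or_odd i with hi | hi
  · obtain ⟨r, hr⟩ := hi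
    have hev : Even i := ⟨r, hr⟩
    have hi2 : i / 2 = r := by omega
    have hlim : Tendsto (fun n : ℕ => (n.choose r : ℝ) * (-(n : ℝ)⁻¹) ^ r) atTop
        (𝓝 ((-1) ^ r / r !)) := by
      have h := (tendsto_descFactorial_div_pow r).const_mul ((-1 : ℝ) ^ r / r !)
      rw [mul_one] at h
      refine h.congr' ?_
      filter_upwards [eventually_gt_atTop 0] with n hn
      have hr0 : (r ! : ℝ) ≠ 0 := by positivity
      have hn0 : (n : ℝ) ≠ 0 := by exact_mod_cast hn.ne'
      have hch : (n.choose r : ℝ) = (n.descFactorial r : ℝ) / r ! := by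
        rw [eq_div_iff hr0, Nat.descFactorial_eq_factorial_mul_choose]
        push_cast
        ring
      rw [hch, neg_pow ((n : ℝ)⁻¹) r, inv_pow]
      simp only [div_eq_mul_inv]
      ring
    rw [expNegSqCoeff, if_pos hev, hi2]
    refine hlim.congr' ?_
    filter_upwards [eventually_ge_atTop r] with n hn
    rw [coeff_gaussApprox, if_pos ⟨hev, by omega⟩, hi2]
  · rw [expNegSqCoeff_of_odd hi]
    have h0 : (fun n => (gaussApprox n).coeff i) = fun _ => 0 := by
      funext n
      rw [coeff_gaussApprox, if_neg (fun h => (Nat.not_even_iff_odd.2 hi) h.1)]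
    rw [h0]
    exact tendsto_const_nhds

/-- `(1 - X²/n)ⁿ = (-1/n)ⁿ (X - √n)ⁿ (X + √n)ⁿ` splits over `ℝ`. [folklore] -/
private theorem splits_gaussApprox (n : ℕ) : (gaussApprox n).Splits := by
  rcases Nat.eq_zero_or_pos n with rfl | hn
  · rw [gaussApprox, pow_zero]; exact Splits.one
  · have hs : Real.sqrt n * Real.sqrt n = (n : ℝ) := Real.mul_self_sqrt (Nat.cast_nonneg n)
    have hn0 : (n : ℝ) ≠ 0 := by exact_mod_cast hn.ne'
    have h1 : (X - C (Real.sqrt (n : ℝ))) * (X + C (Real.sqrt n)) = X ^ 2 - C (n : ℝ) := by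
      calc (X - C (Real.sqrt (n : ℝ))) * (X + C (Real.sqrt n))
          = X ^ 2 - C (Real.sqrt n) * C (Real.sqrt n) := by ring
        _ = X ^ 2 - C (n : ℝ) := by rw [← C_mul, hs]
    have hfac : (1 - C ((n : ℝ)⁻¹) * X ^ 2 : ℝ[X]) =
        C (-(n : ℝ)⁻¹) * ((X - C (Real.sqrt n)) * (X + C (Real.sqrt n))) := by
      rw [h1, mul_sub, ← C_mul, show -(n : ℝ)⁻¹ * n = -1 by field_simp, C_neg, C_neg, C_1]
      ring
    rw [gaussApprox, hfac]
    exact (((Splits.X_sub_C _).mul (Splits.X_add_C _)).C_mul _).pow n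

/-- **Corollary 3.7 of [Osullivan2021] (Pólya 1915 [Po15]; Turán 1959, Lemma II), in the tree's
normalisation, PROVED**: "Let `Σ_{j=0}^{m} a_j z^j` be a hyperbolic polynomial with real
coefficients. Then the polynomial `Σ_{j=0}^{m} a_j H_j(z)` is also hyperbolic." Here with
`H_j(X/2) = gorzHermite j` (the substitution `z = X/2` preserves hyperbolicity):
`(Σ_{j ≤ N} c_j X^j).Splits → (hermiteSum c N).Splits`. Proof: `hermiteSum c N = e^{-D²} p`,
`p = Σ c_j X^j` (`aeval_derivOp_gaussTaylor_sum`), is the coefficientwise limit of `(1 - D²/n)ⁿ p`,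
which are hyperbolic by the Hermite–Poulain theorem since `(1 - y²/n)ⁿ` has the real roots `±√n`;
limits of hyperbolic polynomials of bounded degree are hyperbolic (Hurwitz).
[cite: Osullivan2021, Cor. 3.7] -/
theorem splits_hermiteSum_of_splits (c : ℕ → ℝ) (N : ℕ)
    (h : (∑ j ∈ range (N + 1), C (c j) * X ^ j).Splits) : (hermiteSum c N).Splits := by
  set p : ℝ[X] := ∑ j ∈ range (N + 1), C (c j) * X ^ j with hp_def
  have hp : p.natDegree ≤ N := natDegree_sum_range_C_mul_X_pow_le c N
  have hH : hermiteSum c N = ∑ i ∈ range (N + 1), expNegSqCoeff i • derivative^[i] p := by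
    rw [← aeval_derivOp_gaussTaylor_sum c le_rfl, aeval_derivOp_apply_eq_sum hp]
    refine sum_congr rfl fun i hi => ?_
    rw [coeff_gaussTaylor, if_pos (by have := mem_range.mp hi; omega)]
  refine splits_of_tendsto_coeff (l := atTop) (P := fun n => aeval derivOp (gaussApprox n) p)
    (N := N) (fun n => (natDegree_aeval_derivOp_apply_le _ _).trans hp)
    (hermiteSum_natDegree_le c N) (fun k => ?_)
    (Eventually.of_forall fun n => splits_aeval_derivOp_apply (splits_gaussApprox n) h)
  have hform : ∀ n, (aeval derivOp (gaussApprox n) p).coeff k =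
      ∑ i ∈ range (N + 1), (gaussApprox n).coeff i * (derivative^[i] p).coeff k := fun n => by
    rw [aeval_derivOp_apply_eq_sum hp, finsetSum_coeff]
    simp only [coeff_smul, smul_eq_mul]
  have hlim : (hermiteSum c N).coeff k =
      ∑ i ∈ range (N + 1), expNegSqCoeff i * (derivative^[i] p).coeff k := by
    rw [hH, finsetSum_coeff]
    simp only [coeff_smul, smul_eq_mul]
  simp_rw [hform, hlim]
  exact tendsto_finsetSum _ fun i _ => (tendsto_coeff_gaussApprox i).mul_const _

/-! ## Corollary 3.8: `J^{d,n}` hyperbolic ⟹ `P^{d,n}` hyperbolic -/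

/-- The reciprocal polynomial `X^d J^{d,n}_γ(1/X) = Σ_k (d choose k) γ(n + d - k) X^k` has the
coefficient vector `hermiteJensenCoeff γ d n` of `P^{d,n}_γ` (O'Sullivan, proof of Cor. 3.8).
[cite: Osullivan2021, Cor. 3.8 (proof)] -/
theorem reflect_jensenPoly (γ : ℕ → ℝ) (d n : ℕ) :
    reflect d (jensenPoly γ d n) = ∑ k ∈ range (d + 1), C (hermiteJensenCoeff γ d n k) * X ^ k := by
  ext k
  rw [coeff_reflect, coeff_sum_range_C_mul_X_pow, coeff_jensenPoly]
  by_cases hk : k ≤ d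
  · rw [revAt_le hk, if_pos (Nat.sub_le d k), if_pos hk, hermiteJensenCoeff, Nat.choose_symm hk]
  · have hrev : revAt d k = k := by
      change (if k ≤ d then d - k else k) = k
      rw [if_neg hk]
    rw [hrev, if_neg hk, if_neg hk]

/-- **Corollary 3.8 of [Osullivan2021], PROVED**: "If `J^{d,n}(x)` is hyperbolic then `P^{d,n}(x)` is
hyperbolic" — for an arbitrary real sequence `γ` (the printed proof uses nothing about `ξ`): the
reciprocal `x^d J^{d,n}(1/x)` is hyperbolic (`splits_reflect`) and Cor. 3.7 applies to it.
[cite: Osullivan2021, Cor. 3.8] -/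
theorem osullivan2021_cor3_8 {γ : ℕ → ℝ} {d n : ℕ} (h : (jensenPoly γ d n).Splits) :
    (hermiteJensenPoly γ d n).Splits := by
  have h1 := splits_reflect h (Literature.Analysis.Complex.PolyaSchur.natDegree_jensenPoly_le γ d n)
  rw [reflect_jensenPoly] at h1
  exact splits_hermiteSum_of_splits _ d h1

/-! ## Lemma 3.4 / (3.8) at shift `0`: the Jensen polynomials of `e^{-z²}·Φ` are the reciprocals of `P^{d,0}` -/

/-- The Taylor coefficients (times `k!`) of the Gaussian twist `e^{-w²} · Φ(w)` of
`Φ(w) = Σ γ(i) wⁱ/i!`: `γ̃(k) = k! Σ_{l+i=k} c_l · γ(i)/i!`, `c = expNegSqCoeff` — the sequence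
whose Jensen polynomials are `g_d(Φ · Ω; x)`, `Ω = e^{-z²}` (O'Sullivan, Lemma 3.4 / (3.6)).
[cite: Osullivan2021, Lemma 3.4 and eq. (3.6)] -/
def gaussTwistSeq (γ : ℕ → ℝ) (k : ℕ) : ℝ :=
  (k ! : ℝ) * ∑ p ∈ antidiagonal k, expNegSqCoeff p.1 * (γ p.2 / (p.2 ! : ℝ))

/-- The exponential-generating polynomial `Σ_{i ≤ d} γ(i)/i! · X^i` of a sequence (truncated at
`d`); its Taylor sequence is `γ` up to `d`. [folklore] -/
private def egfPoly (γ : ℕ → ℝ) (d : ℕ) : ℝ[X] := ∑ i ∈ range (d + 1), C (γ i / (i ! : ℝ)) * X ^ i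

/-- Coefficients of `egfPoly`. [folklore] -/
private theorem coeff_egfPoly (γ : ℕ → ℝ) (d k : ℕ) :
    (egfPoly γ d).coeff k = if k ≤ d then γ k / (k ! : ℝ) else 0 :=
  coeff_sum_range_C_mul_X_pow _ d k

/-- The Taylor sequence of `egfPoly γ d` is `γ` up to order `d`. [folklore] -/
private theorem taylorSeq_egfPoly {γ : ℕ → ℝ} {d k : ℕ} (hk : k ≤ d) :
    taylorSeq (egfPoly γ d) k = γ k := by
  rw [taylorSeq, coeff_egfPoly, if_pos hk]
  have : (k ! : ℝ) ≠ 0 := by positivity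
  field_simp

/-- Taylor sequence of `gaussTaylor d · egfPoly γ d` up to order `d` is `gaussTwistSeq γ`. [folklore] -/
private theorem taylorSeq_gaussTaylor_mul_egfPoly {γ : ℕ → ℝ} {d k : ℕ} (hk : k ≤ d) :
    taylorSeq (gaussTaylor d * egfPoly γ d) k = gaussTwistSeq γ k := by
  rw [taylorSeq, gaussTwistSeq, coeff_mul]
  congr 1
  refine sum_congr rfl fun p hp => ?_
  have hpk : p.1 + p.2 = k := mem_antidiagonal.mp hp
  have h1 : p.1 ≤ d := by omega
  have h2 : p.2 ≤ d := by omega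
  rw [coeff_gaussTaylor, if_pos h1, coeff_egfPoly, if_pos h2]

/-- `J^{d,0}` only reads `γ(0), …, γ(d)`. [folklore] -/
private theorem jensenPoly_zero_congr {γ γ' : ℕ → ℝ} {d : ℕ} (h : ∀ k, k ≤ d → γ k = γ' k) :
    jensenPoly γ d 0 = jensenPoly γ' d 0 := by
  ext j
  simp only [coeff_jensenPoly, zero_add]
  split_ifs with hj
  · rw [h j hj]
  · rfl

/-- **O'Sullivan's Lemma 3.4 with (3.8) at shift `0`, PROVED**: the degree-`d` Jensen polynomial
`g_d(e^{-z²}·Φ; x)` of the Gaussian twist of `Φ = Σ γ(i) zⁱ/i!` is the reciprocal polynomial of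
`g*_d(Φ · e^{-z²}; x) = Σ_j (d choose j) γ(j) H_{d-j}(x/2) = P^{d,0}_γ(x/2)`:
`jensenPoly (gaussTwistSeq γ) d 0 = reflect d (hermiteJensenPoly γ d 0)`. Proof in operator form:
`g*_d(ΩΦ; x) = (ΩΦ)(D) x^d = Ω(D)(Φ(D) x^d) = e^{-D²} g*_d(Φ; x)` and Cor. 3.7's identity
`e^{-D²} Σ b_k x^k = Σ b_k H_k(x/2)`. [cite: Osullivan2021, Lemma 3.4 and eq. (3.8)] -/
theorem jensenPoly_gaussTwistSeq_eq_reflect (γ : ℕ → ℝ) (d : ℕ) :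
    jensenPoly (gaussTwistSeq γ) d 0 = reflect d (hermiteJensenPoly γ d 0) := by
  -- `J^{d,0}_{γ̃} = J^{d,0}` of the Taylor sequence of the polynomial `E · Q`
  have h1 : jensenPoly (gaussTwistSeq γ) d 0 = jensenPoly (taylorSeq (gaussTaylor d * egfPoly γ d)) d 0 :=
    jensenPoly_zero_congr fun k hk => (taylorSeq_gaussTaylor_mul_egfPoly hk).symm
  -- `Q(D) X^d` is the reciprocal of `J^{d,0}_γ`
  have h2 : aeval derivOp (egfPoly γ d) ((X : ℝ[X]) ^ d) = reflect d (jensenPoly γ d 0) := by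
    rw [← jensenPoly_zero_congr fun k hk => (taylorSeq_egfPoly (γ := γ) hk),
      jensenPoly_taylorSeq_eq_reflect, reflect_reflect]
  rw [h1, jensenPoly_taylorSeq_eq_reflect, map_mul (aeval derivOp) (gaussTaylor d) (egfPoly γ d),
    Module.End.mul_apply, h2, reflect_jensenPoly, aeval_derivOp_gaussTaylor_sum _ le_rfl,
    hermiteJensenPoly]

/-! ## The Gaussian twist of an entire function: power series bookkeeping -/

/-- `e^{-w²} = Σ_k c_k w^k`, `c = expNegSqCoeff`. [folklore] -/
private theorem hasSum_expNegSqCoeff_mul_pow (w : ℂ) :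
    HasSum (fun k => (expNegSqCoeff k : ℂ) * w ^ k) (Complex.exp (-w ^ 2)) := by
  have he : HasSum (fun r : ℕ => (expNegSqCoeff (2 * r) : ℂ) * w ^ (2 * r))
      (Complex.exp (-w ^ 2)) := by
    rw [Complex.exp_eq_exp_ℂ]
    refine (NormedSpace.expSeries_div_hasSum_exp (-w ^ 2)).congr_fun fun r => ?_
    rw [expNegSqCoeff_two_mul, pow_mul, neg_pow (w ^ 2) r]
    push_cast
    ring
  have ho : HasSum (fun r : ℕ => (expNegSqCoeff (2 * r + 1) : ℂ) * w ^ (2 * r + 1)) 0 := by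
    have : (fun r : ℕ => (expNegSqCoeff (2 * r + 1) : ℂ) * w ^ (2 * r + 1)) = fun _ => 0 := by
      funext r
      rw [expNegSqCoeff_of_odd ⟨r, rfl⟩]
      simp
    rw [this]
    exact hasSum_zero
  have h := HasSum.even_add_odd (f := fun k => (expNegSqCoeff k : ℂ) * w ^ k) he ho
  rwa [add_zero] at h

/-- `Σ_k |c_k| R^k < ∞` (`= e^{R²}`). [folklore] -/
private theorem summable_abs_expNegSqCoeff_mul_pow (R : ℝ) :
    Summable fun k => |expNegSqCoeff k| * R ^ k := by
  refine Summable.even_add_odd ?_ ?_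
  · have h := Real.summable_pow_div_factorial (R ^ 2)
    refine h.congr fun r => ?_
    rw [expNegSqCoeff_two_mul, abs_div, abs_pow, abs_neg, abs_one, one_pow, Nat.abs_cast, pow_mul]
    ring
  · refine (summable_zero).congr fun r => ?_
    rw [expNegSqCoeff_of_odd ⟨r, rfl⟩]
    simp

/-- **The Gaussian twist as a power series**: if `Φ(w) = Σ γ(j) wʲ/j!` (absolutely convergent on
`ℂ`), then `e^{-w²} Φ(w) = Σ_k γ̃(k) wᵏ/k!` with `γ̃ = gaussTwistSeq γ` (Cauchy product).
[cite: Osullivan2021, Lemma 3.4] -/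
theorem hasSum_gaussTwistSeq {γ : ℕ → ℝ} {Φ : ℂ → ℂ}
    (hsum : ∀ R : ℝ, 0 ≤ R → Summable fun j => |γ j| / (j ! : ℝ) * R ^ j)
    (hΦ : ∀ w : ℂ, HasSum (fun j => (γ j : ℂ) / (j ! : ℂ) * w ^ j) (Φ w)) (w : ℂ) :
    HasSum (fun k => (gaussTwistSeq γ k : ℂ) / (k ! : ℂ) * w ^ k) (Complex.exp (-w ^ 2) * Φ w) := by
  set f : ℕ → ℂ := fun l => (expNegSqCoeff l : ℂ) * w ^ l with hf
  set g : ℕ → ℂ := fun i => (γ i : ℂ) / (i ! : ℂ) * w ^ i with hg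
  have hfn : Summable fun l => ‖f l‖ := by
    refine (summable_abs_expNegSqCoeff_mul_pow ‖w‖).congr fun l => ?_
    simp [hf]
  have hgn : Summable fun i => ‖g i‖ := by
    refine (hsum ‖w‖ (norm_nonneg w)).congr fun i => ?_
    simp [hg]
  have hprod := tsum_mul_tsum_eq_tsum_sum_antidiagonal_of_summable_norm' hfn
    (hasSum_expNegSqCoeff_mul_pow w).summable hgn (hΦ w).summable
  rw [(hasSum_expNegSqCoeff_mul_pow w).tsum_eq, (hΦ w).tsum_eq] at hprod
  have hs : Summable fun n => ∑ kl ∈ antidiagonal n, f kl.1 * g kl.2 :=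
    summable_sum_mul_antidiagonal_of_summable_norm' hfn (hasSum_expNegSqCoeff_mul_pow w).summable
      hgn (hΦ w).summable
  have hmain := hs.hasSum
  rw [← hprod] at hmain
  refine hmain.congr_fun fun k => ?_
  -- termwise: `γ̃(k)/k! w^k = Σ_{l+i=k} c_l w^l · γ(i)/i! w^i`
  have hk : (k ! : ℂ) ≠ 0 := by exact_mod_cast Nat.factorial_ne_zero k
  rw [gaussTwistSeq]
  push_cast
  rw [mul_div_cancel_left₀ _ hk, sum_mul]
  refine sum_congr rfl fun p hp => ?_
  have hpk : p.1 + p.2 = k := mem_antidiagonal.mp hp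
  simp only [hf, hg]
  rw [← hpk, pow_add]
  ring

/-- The majorant series of the Gaussian twist converges: `Σ |γ̃(k)|/k! Rᵏ < ∞`. [folklore] -/
private theorem summable_abs_gaussTwistSeq {γ : ℕ → ℝ}
    (hsum : ∀ R : ℝ, 0 ≤ R → Summable fun j => |γ j| / (j ! : ℝ) * R ^ j) (R : ℝ) (hR : 0 ≤ R) :
    Summable fun k => |gaussTwistSeq γ k| / (k ! : ℝ) * R ^ k := by
  set f : ℕ → ℝ := fun l => |expNegSqCoeff l| * R ^ l with hf
  set g : ℕ → ℝ := fun i => |γ i| / (i ! : ℝ) * R ^ i with hg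
  have hf0 : ∀ l, 0 ≤ f l := fun l => by positivity
  have hg0 : ∀ i, 0 ≤ g i := fun i => by positivity
  have hfs : Summable f := summable_abs_expNegSqCoeff_mul_pow R
  have hgs : Summable g := hsum R hR
  have hfn : Summable fun l => ‖f l‖ := hfs.congr fun l => by rw [Real.norm_of_nonneg (hf0 l)]
  have hgn : Summable fun i => ‖g i‖ := hgs.congr fun i => by rw [Real.norm_of_nonneg (hg0 i)]
  have hs : Summable fun n => ∑ kl ∈ antidiagonal n, f kl.1 * g kl.2 :=
    summable_sum_mul_antidiagonal_of_summable_norm' hfn hfs hgn hgs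
  refine hs.of_nonneg_of_le (fun k => by positivity) fun k => ?_
  have hk : (0 : ℝ) < k ! := by exact_mod_cast Nat.factorial_pos k
  rw [gaussTwistSeq, abs_mul, Nat.abs_cast, mul_div_cancel_left₀ _ hk.ne']
  calc |∑ p ∈ antidiagonal k, expNegSqCoeff p.1 * (γ p.2 / (p.2 ! : ℝ))| * R ^ k
      ≤ (∑ p ∈ antidiagonal k, |expNegSqCoeff p.1 * (γ p.2 / (p.2 ! : ℝ))|) * R ^ k := by
        gcongr; exact abs_sum_le_sum_abs _ _
    _ = ∑ p ∈ antidiagonal k, f p.1 * g p.2 := by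
        rw [sum_mul]
        refine sum_congr rfl fun p hp => ?_
        have hpk : p.1 + p.2 = k := mem_antidiagonal.mp hp
        simp only [hf, hg]
        rw [abs_mul, abs_div, Nat.abs_cast, ← hpk, pow_add]
        ring

/-! ## Theorem 1.2 -/

/-- **The hard half of O'Sullivan's Theorem 1.2, in the shift-zero form of Theorem 3.5, PROVED**:
if `P^{d,0}_γ` (`γ = xiTaylorCoeff`) is hyperbolic for every `d ≥ 1`, then the Riemann hypothesis
holds. As printed (proof of Thm. 3.5 / Thm. 1.2 with `Φ = Θ`, `Ω = e^{-z²}`, and the easy direction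
of Pólya–Schur, Thm. 3.1): the Jensen polynomials `g_d(ΘΩ)` are the reciprocals of the
`P^{d,0}(x/2)` (`jensenPoly_gaussTwistSeq_eq_reflect`), hence hyperbolic; `g_d(ΘΩ; w/d) → Θ(w)Ω(w)`
locally uniformly, so by Hurwitz `Θ · e^{-w²}`, hence `Θ(w) = ξ(½ + √w)`, has only real zeros,
which is RH. [cite: Osullivan2021, Thm. 3.5 and proof of Thm. 1.2] -/
theorem riemannHypothesis_of_forall_splits_hermiteJensenPoly_zero
    (h : ∀ d : ℕ, 1 ≤ d → (hermiteJensenPoly xiTaylorCoeff d 0).Splits) : RiemannHypothesis := by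
  refine riemannHypothesis_of_forall_xiSq_eq_zero_im_eq_zero fun z hz => ?_
  have hs : ∀ d : ℕ, (jensenPoly (gaussTwistSeq xiTaylorCoeff) d 0).Splits := by
    intro d
    rcases Nat.eq_zero_or_pos d with rfl | hd
    · exact Splits.of_natDegree_eq_zero (Nat.le_zero.mp
        (Literature.Analysis.Complex.PolyaSchur.natDegree_jensenPoly_le _ 0 0))
    · rw [jensenPoly_gaussTwistSeq_eq_reflect]
      exact splits_reflect (h d hd) (natDegree_hermiteJensenPoly_le _ _ _)
  have hF := hasSum_gaussTwistSeq summable_abs_xiTaylorCoeff_div_factorial_mul_pow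
    hasSum_xiTaylorCoeff_div_factorial_mul_pow
  refine im_eq_zero_of_forall_splits_jensenPoly
    (summable_abs_gaussTwistSeq summable_abs_xiTaylorCoeff_div_factorial_mul_pow) hF ?_ ?_ hs ?_
  · exact (Complex.differentiable_exp.comp (differentiable_pow 2).neg).mul
      (differentiable_xiSq.const_mul 8)
  · simpa using xiSq_zero_ne
  · simp [hz]

/-- **RH ⟺ every `P^{d,0}`, `d ≥ 1`, is hyperbolic** (O'Sullivan, Thm. 3.5 at `n = 0` with
`Ω = e^{-z²}`: "`Θ` is hyperbolic iff the polynomials `g*_d(Θ·e^{-z²}; x) = P^{d,0}(x/2)` are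
hyperbolic for all `d ≥ 1`", and `Θ` hyperbolic ⟺ RH), PROVED. The `rh-jensen` theory seat's
`HermiteJensenShiftZero`. [cite: Osullivan2021, Thm. 3.5 and eq. (3.8)] -/
theorem riemannHypothesis_iff_forall_splits_hermiteJensenPoly_zero :
    RiemannHypothesis ↔ ∀ d : ℕ, 1 ≤ d → (hermiteJensenPoly xiTaylorCoeff d 0).Splits := by
  refine ⟨fun hRH d _ => ?_, riemannHypothesis_of_forall_splits_hermiteJensenPoly_zero⟩
  have hJ : JensenPolyaCriterion := jensenPolyaCriterion_of_riemannHypothesis hRH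
  exact osullivan2021_cor3_8 ((show ∀ d n : ℕ, (jensenPoly xiTaylorCoeff d n).Splits from hJ) d 0)

/-- **O'Sullivan 2021, Theorem 1.2, PROVED**: "The Riemann hypothesis is true if and only if
`P^{d,n}(X)` is hyperbolic for all `d ≥ 1`, `n ≥ 0`." (`P^{d,n}(X/2) = hermiteJensenPoly γ d n`,
`γ = xiTaylorCoeff = 8 ×` O'Sullivan's `γ`.) ⟹: Pólya's criterion (tree: `polya_jensen_holds`)
and Cor. 3.8; ⟸: already the shifts `n = 0` suffice
(`riemannHypothesis_of_forall_splits_hermiteJensenPoly_zero`). The `rh-jensen` theory seat's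
`HermiteJensenCriterion`. [cite: Osullivan2021, Thm. 1.2] -/
theorem osullivan2021_thm1_2 :
    RiemannHypothesis ↔ ∀ d n : ℕ, 1 ≤ d → (hermiteJensenPoly xiTaylorCoeff d n).Splits := by
  refine ⟨fun hRH d n _ => ?_,
    fun h => riemannHypothesis_of_forall_splits_hermiteJensenPoly_zero fun d hd => h d 0 hd⟩
  have hJ : JensenPolyaCriterion := jensenPolyaCriterion_of_riemannHypothesis hRH
  exact osullivan2021_cor3_8 ((show ∀ d n : ℕ, (jensenPoly xiTaylorCoeff d n).Splits from hJ) d n)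

/-! ## Theorem 1.3 (named fact) -/

/-- **O'Sullivan 2021, Theorem 1.3, as printed** (NAMED FACT, not proved here): "For all `d`
sufficiently large, `P^{d,n}(X)` is hyperbolic whenever `n/log² n ≥ d^{3/4}/2`." Typed with
`P^{d,n}(X/2) = hermiteJensenPoly xiTaylorCoeff d n` (same hyperbolicity) and `n ≥ 2` (for
`n ≤ 1` the printed hypothesis `n/log² n ≥ d^{3/4}/2` is meaningless, `log 1 = 0`). The threshold
"`d` sufficiently large" is INEFFECTIVE in print: the proof (§8, via Thm. 8.1 = Turán's criterion,
tree `splits_hermiteSum_of_turan`, and Lemma 8.2) uses the asymptotic expansion Thm. 1.4 of `γ(n)`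
with unspecified `O`-constants ("for `n` large enough", (8.4)–(8.5)). Exponent `3/4` in `d`,
against `n ≫ e^{d}` (GORTTW, `gorttw_thm1_1`) and `O(d^{1/2+ε})` ineffective (Kim–Lee, `kimLee_thm1`)
on the `J`-row; by Cor. 3.8 the `P`-row is cellwise weaker. [cite: Osullivan2021, Thm. 1.3] -/
def osullivan2021_thm1_3 : Prop :=
  ∃ d₀ : ℕ, ∀ d n : ℕ, d₀ ≤ d → 2 ≤ n →
    (d : ℝ) ^ (3 / 4 : ℝ) / 2 ≤ (n : ℝ) / Real.log n ^ 2 →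
      (hermiteJensenPoly xiTaylorCoeff d n).Splits

end Literature.NumberTheory.LFunctions

end
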